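import Literature.Analysis.FluidPDE.ClassicalSuitable
import HarnessLib

/-!
# Classical solutions of the drift system: the weak identity and the local energy equality against
# space–time test functions

Analysis/FluidPDE theorem file (no definitions, no named facts): the drift twin of
`ClassicalSuitable.lean`. For a classical solution of the Navier–Stokes system **with a prescribed
divergence-free drift** `a`,

  `∂ₜu + (a·∇)u = νΔu − ∇p + f`, `div u = 0`, `div a = 0`                            (∗)

(Leray 1934, (5.1): Leray's regularised system is (∗) with `a = J_ε u`; Ożański–Pooley 2018,
(6.77)), jointly `C²`/`C¹` on an open slab `S × E`, and an open space–time region `Q ⊆ S × E`: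

* `integral_inner_dt_test_of_drift_momentum`, `integral_mul_inner_dt_of_drift_momentum`,
  `integral_energy_flux_eq_of_drift_momentum` — the slice identities (the momentum equation paired
  with a compactly supported field, resp. with `φ u`, integrated by parts in space: the transport
  term moves onto the test field through `div a = 0`, `∫ φ ⟪(a·∇)u, u⟫ = −½ ∫ |u|² a·∇φ`);
* `setIntegral_drift_weak_identity_of_contDiffOn` — for every vector test field `ψ` on `Q`,
  `∫∫_Q (⟪u, ∂ₜψ⟫ + ⟪u, (a·∇)ψ⟫ + ν⟪u, Δψ⟫ + p div ψ + ⟪f, ψ⟫) = 0`;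
* `drift_local_energy_eq_of_contDiffOn` — for every scalar test function `φ` on `Q`,
  `2ν ∫∫ |∇u|² φ = ∫∫ (|u|²(∂ₜφ + νΔφ) + |u|² a·∇φ + 2p u·∇φ + 2⟪f, u⟫φ)` — Leray's local energy
  *equality* for the regularised system (Leray 1934, §27, (5.3); Caffarelli–Kohn–Nirenberg 1982,
  §2, (2.5) with equality for smooth solutions, transport velocity `a`).

These are the identities of the approximants that pass to the limit in the proof that Leray's weak
solutions are suitable (`LeraySuitable*.lean`). The proofs are those of `ClassicalSuitable.lean`
verbatim (its space–time tools — pairing in time, Fubini for continuous compactly supported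
integrands — are reused by name), with the convecting velocity `u` replaced by the drift `a`.

## References

* J. Leray, Acta Math. 63 (1934), Ch. V §26 (5.1), §27 (5.3). [Leray1934]
* L. Caffarelli, R. Kohn, L. Nirenberg, CPAM 35 (1982), §2 (2.2), (2.5). [CaffarelliKohnNirenberg1982]
* W. S. Ożański, B. C. Pooley, LMS Lecture Note Ser. 452 (2018), (6.77), Lemma 6.34. [OzanskiPooley2018]
-/

noncomputable section

open MeasureTheory TopologicalSpace Set Function Filter Topology Metric
open scoped Laplacian InnerProductSpace RealInnerProductSpace ENNReal NNReal ContDiff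

namespace Literature.Analysis.FluidPDE

variable {E : Type*} [NormedAddCommGroup E] [InnerProductSpace ℝ E] [FiniteDimensional ℝ E]
  [MeasurableSpace E] [BorelSpace E]

/-! ### Slice identities -/

section Slice

variable {ν : ℝ} {u a dtu f : E → E} {p : E → ℝ}

/-- **The drift momentum equation against a test field, at a fixed time**: for `u ∈ C²`,
`a ∈ C¹` divergence free, `p ∈ C¹`, `dtu, f` continuous with `dtu + (a·∇)u = νΔu − ∇p + f`, and
`ψ ∈ C²_c`, `∫ ⟪dtu, ψ⟫ = ∫ (⟪u, (a·∇)ψ⟫ + ν ⟪u, Δψ⟫ + p div ψ + ⟪f, ψ⟫)` (Leray 1934, (5.1)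
paired with a test field as in (5.15)). [cite: Leray1934, Ch. V §26 (5.1)] -/
theorem integral_inner_dt_test_of_drift_momentum (hu : ContDiff ℝ 2 u) (ha : ContDiff ℝ 1 a)
    (hp : ContDiff ℝ 1 p) (hdt : Continuous dtu) (hf : Continuous f)
    (hmom : ∀ x, dtu x + convect a u x = ν • (Δ u) x - gradient p x + f x)
    (hdiva : VectorCalculus.IsDivFree a) {ψ : E → E} (hψ : ContDiff ℝ 2 ψ)
    (hc : HasCompactSupport ψ) :
    ∫ x, ⟪dtu x, ψ x⟫ =
      ∫ x, (⟪u x, convect a ψ x⟫ + ν * ⟪u x, (Δ ψ) x⟫ +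
        p x * VectorCalculus.divergence ψ x + ⟪f x, ψ x⟫) := by
  have hu1 : ContDiff ℝ 1 u := hu.of_le one_le_two
  have hψ1 : ContDiff ℝ 1 ψ := hψ.of_le one_le_two
  have huc : Continuous u := hu1.continuous
  have hac : Continuous a := ha.continuous
  have hψc : Continuous ψ := hψ1.continuous
  -- the force through the equation
  have hf_eq : ∀ x, f x = dtu x + convect a u x - ν • (Δ u) x + gradient p x := fun x => by
    have := hmom x
    rw [eq_comm, ← sub_eq_zero] at this
    rw [← sub_eq_zero, ← this]
    abel
  -- integrability of every pairing with `ψ`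
  have iT := integrable_inner_of_hasCompactSupport_right hdt hψc hc
  have iC : Integrable (fun x => ⟪convect a u x, ψ x⟫) (volume : Measure E) :=
    integrable_inner_of_hasCompactSupport_right
      ((hu1.continuous_fderiv one_ne_zero).clm_apply hac) hψc hc
  have iL := integrable_inner_of_hasCompactSupport_right (continuous_laplacian hu) hψc hc
  have iP := integrable_inner_of_hasCompactSupport_right (continuous_gradient_of_contDiff hp)
    hψc hc
  have iF := integrable_inner_of_hasCompactSupport_right hf hψc hc
  have iC' : Integrable (fun x => ⟪u x, convect a ψ x⟫) (volume : Measure E) :=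
    integrable_inner_of_hasCompactSupport_right huc
      ((hψ1.continuous_fderiv one_ne_zero).clm_apply hac)
      ((hc.fderiv (𝕜 := ℝ)).mono fun x hx => by
        contrapose! hx; simp only [mem_support, not_not] at hx; simp [convect, hx])
  have iL' : Integrable (fun x => ⟪u x, (Δ ψ) x⟫) (volume : Measure E) :=
    integrable_inner_of_hasCompactSupport_right huc (continuous_laplacian hψ)
      (hc.mono' fun x hx => by
        contrapose! hx; simp [laplacian_eq_zero_of_notMem_tsupport hx])
  have iD : Integrable (fun x => p x * VectorCalculus.divergence ψ x) (volume : Measure E) := by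
    refine (hp.continuous.mul (continuous_divergence (hψ1.continuous_fderiv one_ne_zero)))
      |>.integrable_of_hasCompactSupport ?_
    refine hc.mono' fun x hx => ?_
    contrapose! hx
    simp [divergence_eq_zero_of_notMem_tsupport hx]
  -- integration by parts, term by term
  have eC : ∫ x, ⟪convect a u x, ψ x⟫ = -∫ x, ⟪u x, convect a ψ x⟫ := by
    have h0 := integral_inner_convect_add_eq_zero ha hu1 hψ1 hc
    have hz : ∫ x, VectorCalculus.divergence a x * ⟪u x, ψ x⟫ = 0 := by simp [hdiva _]
    linarith
  have eL : ∫ x, ⟪(Δ u) x, ψ x⟫ = ∫ x, ⟪u x, (Δ ψ) x⟫ := integral_inner_laplacian_comm hu hψ hc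
  have eP : ∫ x, ⟪gradient p x, ψ x⟫ = -∫ x, p x * VectorCalculus.divergence ψ x :=
    integral_inner_gradient_eq_neg_integral_mul_divergence hp hψ1 hc
  -- assemble
  have key : ∀ x, ⟪dtu x, ψ x⟫ = ⟪f x, ψ x⟫ -
      ⟪convect a u x, ψ x⟫ + ν * ⟪(Δ u) x, ψ x⟫ - ⟪gradient p x, ψ x⟫ := by
    intro x
    rw [hf_eq x]
    simp only [inner_add_left, inner_sub_left, inner_smul_left, RCLike.conj_to_real]
    ring
  have j1 : Integrable (fun x => ⟪f x, ψ x⟫ - ⟪convect a u x, ψ x⟫) (volume : Measure E) :=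
    iF.sub iC
  have j2 : Integrable (fun x => ν * ⟪(Δ u) x, ψ x⟫) (volume : Measure E) := iL.const_mul ν
  have j3 : Integrable (fun x => ⟪f x, ψ x⟫ - ⟪convect a u x, ψ x⟫ + ν * ⟪(Δ u) x, ψ x⟫)
      (volume : Measure E) := j1.add j2
  have j4 : Integrable (fun x => ν * ⟪u x, (Δ ψ) x⟫) (volume : Measure E) := iL'.const_mul ν
  have j5 : Integrable (fun x => ⟪u x, convect a ψ x⟫ + ν * ⟪u x, (Δ ψ) x⟫)
      (volume : Measure E) := iC'.add j4
  have j6 : Integrable (fun x => ⟪u x, convect a ψ x⟫ + ν * ⟪u x, (Δ ψ) x⟫ +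
      p x * VectorCalculus.divergence ψ x) (volume : Measure E) := j5.add iD
  rw [integral_congr_ae (Eventually.of_forall key), integral_sub j3 iP, integral_add j1 j2,
    integral_sub iF iC, integral_const_mul, integral_add j6 iF, integral_add j5 iD,
    integral_add iC' j4, integral_const_mul, eC, eL, eP]
  ring

/-- **The drift momentum equation against `φ u`, at a fixed time** (the slice form of Leray's
local energy equality for the regularised system, Leray 1934, §27, derivation of (5.3)): with
`div a = 0` and `div u = 0`,
`∫ φ ⟪dtu, u⟫ = ½ ∫ (Dφ·a)|u|² − ν ∫ φ |∇u|² + (ν/2) ∫ Δφ |u|² + ∫ p (Dφ·u) + ∫ φ ⟪f, u⟫`.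
[cite: Leray1934, Ch. V §27 (5.3)] -/
theorem integral_mul_inner_dt_of_drift_momentum (hu : ContDiff ℝ 2 u) (ha : ContDiff ℝ 1 a)
    (hp : ContDiff ℝ 1 p) (hdt : Continuous dtu) (hf : Continuous f)
    (hmom : ∀ x, dtu x + convect a u x = ν • (Δ u) x - gradient p x + f x)
    (hdiva : VectorCalculus.IsDivFree a) (hdiv : VectorCalculus.IsDivFree u)
    {φ : E → ℝ} (hφ : ContDiff ℝ 2 φ) (hc : HasCompactSupport φ) :
    ∫ x, φ x * ⟪dtu x, u x⟫ =
      2⁻¹ * (∫ x, fderiv ℝ φ x (a x) * ‖u x‖ ^ 2)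
      - ν * (∫ x, φ x * frobeniusNormSq (fderiv ℝ u x))
      + 2⁻¹ * ν * (∫ x, (Δ φ) x * ‖u x‖ ^ 2)
      + (∫ x, p x * fderiv ℝ φ x (u x))
      + ∫ x, φ x * ⟪f x, u x⟫ := by
  set b := stdOrthonormalBasis ℝ E
  have hφ1 : ContDiff ℝ 1 φ := hφ.of_le one_le_two
  set w : E → E := fun x => φ x • u x with hw
  -- regularity
  have hu1 : ContDiff ℝ 1 u := hu.of_le one_le_two
  have hw1 : ContDiff ℝ 1 w := hφ1.smul hu1
  have hcw : HasCompactSupport w := hc.smul_right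
  have huc : Continuous u := hu1.continuous
  have hac : Continuous a := ha.continuous
  have hφc : Continuous φ := hφ1.continuous
  have hDφc : Continuous (fderiv ℝ φ) := hφ1.continuous_fderiv one_ne_zero
  have hDuc : Continuous (fderiv ℝ u) := hu1.continuous_fderiv one_ne_zero
  have hwc : Continuous w := hw1.continuous
  have hcDφ : HasCompactSupport (fderiv ℝ φ) := hc.fderiv (𝕜 := ℝ)
  -- the force through the equation
  have hf_eq : ∀ x, f x = dtu x + convect a u x - ν • (Δ u) x + gradient p x := fun x => by
    have := hmom x
    rw [eq_comm, ← sub_eq_zero] at this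
    rw [← sub_eq_zero, ← this]
    abel
  -- pointwise Leibniz rules for `w = φ u`
  have hDw : ∀ x v, fderiv ℝ w x v = φ x • fderiv ℝ u x v + (fderiv ℝ φ x v) • u x :=
    fun x v => by
      simp [hw, fderiv_fun_smul (hφ1.differentiable one_ne_zero x) (hu1.differentiable one_ne_zero x)]
  have hCw : ∀ x, convect a w x = φ x • convect a u x + (fderiv ℝ φ x (a x)) • u x :=
    fun x => convect_smul_apply (hφ1.differentiable one_ne_zero x) (hu1.differentiable one_ne_zero x)
  -- integrability of every term (continuous with compact support)
  have cs_φ : ∀ {g : E → ℝ}, Continuous g → Integrable (fun x => φ x * g x) (volume : Measure E) :=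
    fun hg => (hφc.mul hg).integrable_of_hasCompactSupport hc.mul_right
  have cs_Dφ : ∀ {g : E → ℝ} (v : E → E), Continuous g → Continuous v →
      Integrable (fun x => fderiv ℝ φ x (v x) * g x) (volume : Measure E) := fun v hg hv =>
    ((hDφc.clm_apply hv).mul hg).integrable_of_hasCompactSupport
      ((hcDφ.mono fun x hx => by contrapose! hx; simp_all).mul_right)
  -- (i) the convection term
  have eC : ∫ x, ⟪convect a u x, w x⟫ = -(2⁻¹ * ∫ x, fderiv ℝ φ x (a x) * ‖u x‖ ^ 2) := by
    have h0 := integral_inner_convect_add_eq_zero ha hu1 hw1 hcw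
    have hz : ∫ x, VectorCalculus.divergence a x * ⟪u x, w x⟫ = 0 := by simp [hdiva _]
    have hA : ∫ x, ⟪convect a u x, w x⟫ = ∫ x, φ x * ⟪u x, convect a u x⟫ :=
      integral_congr_ae (Eventually.of_forall fun x => by
        simp only [hw, real_inner_smul_right]
        rw [real_inner_comm])
    have iA : Integrable (fun x => φ x * ⟪u x, convect a u x⟫) (volume : Measure E) :=
      cs_φ (huc.inner (hDuc.clm_apply hac))
    have iB : Integrable (fun x => fderiv ℝ φ x (a x) * ‖u x‖ ^ 2) (volume : Measure E) :=
      cs_Dφ _ (huc.norm.pow 2) hac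
    have hB : ∫ x, ⟪u x, convect a w x⟫ = (∫ x, φ x * ⟪u x, convect a u x⟫) +
        ∫ x, fderiv ℝ φ x (a x) * ‖u x‖ ^ 2 := by
      rw [← integral_add iA iB]
      refine integral_congr_ae (Eventually.of_forall fun x => ?_)
      simp only [hCw, inner_add_right, real_inner_smul_right, real_inner_self_eq_norm_sq]
    rw [hA] at h0 ⊢
    linarith
  -- (ii) the viscous term
  have eL : ∫ x, ⟪(Δ u) x, w x⟫ = -(∫ x, φ x * frobeniusNormSq (fderiv ℝ u x)) +
      2⁻¹ * ∫ x, (Δ φ) x * ‖u x‖ ^ 2 := by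
    have h0 := integral_inner_laplacian_add_eq_zero b hu hw1 (Or.inr hcw)
    have iA : ∀ i, Integrable (fun x => φ x * ‖fderiv ℝ u x (b i)‖ ^ 2) (volume : Measure E) :=
      fun i => cs_φ ((hDuc.clm_apply continuous_const).norm.pow 2)
    have iB : ∀ i, Integrable (fun x => fderiv ℝ φ x (b i) * ⟪fderiv ℝ u x (b i), u x⟫)
        (volume : Measure E) := fun i =>
      cs_Dφ _ ((hDuc.clm_apply continuous_const).inner huc) continuous_const
    have h1 : ∀ i, ∫ x, ⟪fderiv ℝ u x (b i), fderiv ℝ w x (b i)⟫ =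
        (∫ x, φ x * ‖fderiv ℝ u x (b i)‖ ^ 2) +
          ∫ x, fderiv ℝ φ x (b i) * ⟪fderiv ℝ u x (b i), u x⟫ := fun i => by
      rw [← integral_add (iA i) (iB i)]
      refine integral_congr_ae (Eventually.of_forall fun x => ?_)
      simp only [hDw, inner_add_right, real_inner_smul_right, real_inner_self_eq_norm_sq]
    have h2 : ∑ i, ∫ x, φ x * ‖fderiv ℝ u x (b i)‖ ^ 2 =
        ∫ x, φ x * frobeniusNormSq (fderiv ℝ u x) := by
      rw [← integral_finsetSum _ fun i _ => iA i]
      refine integral_congr_ae (Eventually.of_forall fun x => ?_)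
      simp only [frobeniusNormSq_eq_sum b, Finset.mul_sum]
    have h3 := sum_integral_fderiv_mul_inner_fderiv_eq hφ hc hu1
    simp_rw [h1] at h0
    rw [Finset.sum_add_distrib, h2, h3] at h0
    linarith
  -- (iii) the pressure term
  have eP : ∫ x, ⟪gradient p x, w x⟫ = -∫ x, p x * fderiv ℝ φ x (u x) := by
    rw [integral_inner_gradient_eq_neg_integral_mul_divergence hp hw1 hcw]
    congr 1
    refine integral_congr_ae (Eventually.of_forall fun x => ?_)
    simp only [hw]
    rw [divergence_smul_apply (hφ1.differentiable one_ne_zero x) (hu1.differentiable one_ne_zero x),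
      hdiv x, mul_zero, zero_add, gradient, real_inner_comm, InnerProductSpace.toDual_symm_apply]
  -- integrability of the paired terms
  have iT : Integrable (fun x => ⟪dtu x, w x⟫) (volume : Measure E) :=
    integrable_inner_of_hasCompactSupport_right hdt hwc hcw
  have iC : Integrable (fun x => ⟪convect a u x, w x⟫) (volume : Measure E) :=
    integrable_inner_of_hasCompactSupport_right (hDuc.clm_apply hac) hwc hcw
  have iL : Integrable (fun x => ⟪(Δ u) x, w x⟫) (volume : Measure E) :=
    integrable_inner_of_hasCompactSupport_right (continuous_laplacian hu) hwc hcw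
  have iP : Integrable (fun x => ⟪gradient p x, w x⟫) (volume : Measure E) :=
    integrable_inner_of_hasCompactSupport_right (continuous_gradient_of_contDiff hp) hwc hcw
  have iF : Integrable (fun x => ⟪f x, w x⟫) (volume : Measure E) :=
    integrable_inner_of_hasCompactSupport_right hf hwc hcw
  -- assemble
  have hL : ∫ x, φ x * ⟪dtu x, u x⟫ = ∫ x, ⟪dtu x, w x⟫ :=
    integral_congr_ae (Eventually.of_forall fun x => by simp only [hw, real_inner_smul_right])
  have hF : ∫ x, φ x * ⟪f x, u x⟫ = ∫ x, ⟪f x, w x⟫ :=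
    integral_congr_ae (Eventually.of_forall fun x => by simp only [hw, real_inner_smul_right])
  have key : ∀ x, ⟪dtu x, w x⟫ = ⟪f x, w x⟫ -
      ⟪convect a u x, w x⟫ + ν * ⟪(Δ u) x, w x⟫ - ⟪gradient p x, w x⟫ := by
    intro x
    rw [hf_eq x]
    simp only [inner_add_left, inner_sub_left, inner_smul_left, RCLike.conj_to_real]
    ring
  have j1 : Integrable (fun x => ⟪f x, w x⟫ - ⟪convect a u x, w x⟫) (volume : Measure E) :=
    iF.sub iC
  have j2 : Integrable (fun x => ν * ⟪(Δ u) x, w x⟫) (volume : Measure E) := iL.const_mul ν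
  have j3 : Integrable (fun x => ⟪f x, w x⟫ - ⟪convect a u x, w x⟫ + ν * ⟪(Δ u) x, w x⟫)
      (volume : Measure E) := j1.add j2
  rw [hL, hF, integral_congr_ae (Eventually.of_forall key), integral_sub j3 iP, integral_add j1 j2,
    integral_sub iF iC, integral_const_mul, eC, eL, eP]
  ring

/-- The local energy balance at a fixed time, rearranged as it enters the space–time identity:
`∫ (ν Δφ |u|² + (Dφ·u)|u|² + 2 p (Dφ·u) + 2 φ ⟪f, u⟫) = ∫ 2 φ ⟪u, dtu⟫ + 2ν ∫ |∇u|² φ`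
(Caffarelli–Kohn–Nirenberg 1982, §2, (2.5) with equality for smooth solutions). [cite: CaffarelliKohnNirenberg1982, §2 (2.5)] -/
theorem integral_energy_flux_eq_of_drift_momentum (hu : ContDiff ℝ 2 u) (ha : ContDiff ℝ 1 a)
    (hp : ContDiff ℝ 1 p) (hdt : Continuous dtu) (hf : Continuous f)
    (hmom : ∀ x, dtu x + convect a u x = ν • (Δ u) x - gradient p x + f x)
    (hdiva : VectorCalculus.IsDivFree a) (hdiv : VectorCalculus.IsDivFree u)
    {φ : E → ℝ} (hφ : ContDiff ℝ 2 φ) (hc : HasCompactSupport φ) :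
    ∫ x, (ν * ((Δ φ) x * ‖u x‖ ^ 2) + fderiv ℝ φ x (a x) * ‖u x‖ ^ 2 +
        2 * (p x * fderiv ℝ φ x (u x)) + 2 * (φ x * ⟪f x, u x⟫)) =
      (∫ x, φ x * (2 * ⟪u x, dtu x⟫)) + 2 * ν * ∫ x, frobeniusNormSq (fderiv ℝ u x) * φ x := by
  have h0 := integral_mul_inner_dt_of_drift_momentum hu ha hp hdt hf hmom hdiva hdiv hφ hc
  have hu1 : ContDiff ℝ 1 u := hu.of_le one_le_two
  have hφ1 : ContDiff ℝ 1 φ := hφ.of_le one_le_two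
  have huc : Continuous u := hu1.continuous
  have hac : Continuous a := ha.continuous
  have hφc : Continuous φ := hφ1.continuous
  have hDφc : Continuous (fderiv ℝ φ) := hφ1.continuous_fderiv one_ne_zero
  have hDuc : Continuous (fderiv ℝ u) := hu1.continuous_fderiv one_ne_zero
  have hcDφ : HasCompactSupport (fderiv ℝ φ) := hc.fderiv (𝕜 := ℝ)
  have cs_φ : ∀ {g : E → ℝ}, Continuous g → Integrable (fun x => φ x * g x) (volume : Measure E) :=
    fun hg => (hφc.mul hg).integrable_of_hasCompactSupport hc.mul_right
  have cs_Dφ : ∀ {g : E → ℝ} (v : E → E), Continuous g → Continuous v →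
      Integrable (fun x => fderiv ℝ φ x (v x) * g x) (volume : Measure E) := fun v hg hv =>
    ((hDφc.clm_apply hv).mul hg).integrable_of_hasCompactSupport
      ((hcDφ.mono fun x hx => by contrapose! hx; simp_all).mul_right)
  have i1 : Integrable (fun x => ν * ((Δ φ) x * ‖u x‖ ^ 2)) (volume : Measure E) := by
    refine (((continuous_laplacian hφ).mul (huc.norm.pow 2)).integrable_of_hasCompactSupport
      ?_).const_mul ν
    exact (hc.mono' fun x hx => by
      contrapose! hx; simp [laplacian_eq_zero_of_notMem_tsupport hx]).mul_right
  have i2 : Integrable (fun x => fderiv ℝ φ x (a x) * ‖u x‖ ^ 2) (volume : Measure E) :=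
    cs_Dφ _ (huc.norm.pow 2) hac
  have i3 : Integrable (fun x => 2 * (p x * fderiv ℝ φ x (u x))) (volume : Measure E) := by
    have := cs_Dφ _ hp.continuous huc
    refine (this.congr (Eventually.of_forall fun x => ?_)).const_mul 2
    simp only [mul_comm]
  have i4 : Integrable (fun x => 2 * (φ x * ⟪f x, u x⟫)) (volume : Measure E) :=
    (cs_φ (hf.inner huc)).const_mul 2
  have e1 : ∫ x, φ x * (2 * ⟪u x, dtu x⟫) = 2 * ∫ x, φ x * ⟪dtu x, u x⟫ := by
    rw [← integral_const_mul]
    refine integral_congr_ae (Eventually.of_forall fun x => ?_)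
    show φ x * (2 * ⟪u x, dtu x⟫) = 2 * (φ x * ⟪dtu x, u x⟫)
    rw [real_inner_comm]
    ring
  have e2 : ∫ x, frobeniusNormSq (fderiv ℝ u x) * φ x = ∫ x, φ x * frobeniusNormSq (fderiv ℝ u x) :=
    integral_congr_ae (Eventually.of_forall fun x => mul_comm _ _)
  have i12 : Integrable (fun x => ν * ((Δ φ) x * ‖u x‖ ^ 2) + fderiv ℝ φ x (a x) * ‖u x‖ ^ 2)
      (volume : Measure E) := i1.add i2
  have i123 : Integrable (fun x => ν * ((Δ φ) x * ‖u x‖ ^ 2) + fderiv ℝ φ x (a x) * ‖u x‖ ^ 2 +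
      2 * (p x * fderiv ℝ φ x (u x))) (volume : Measure E) := i12.add i3
  rw [integral_add i123 i4, integral_add i12 i3, integral_add i1 i2,
    integral_const_mul, integral_const_mul, integral_const_mul, e1, e2, h0]
  ring

end Slice

/-! ### Space–time identities on an open region `Q ⊆ S × E` -/

section SpaceTime

variable {F : Type*} [NormedAddCommGroup F] [NormedSpace ℝ F]
variable {S : Set ℝ} {Q : Opens (ℝ × E)} {ν : ℝ} {f u b : ℝ → E → E} {p : ℝ → E → ℝ}

/-- **The weak identity of a classical drift solution against space–time test fields.** Let `S`
be open, `Q ⊆ S × E` open, `u` jointly `C²`, `b, p` jointly `C¹`, `f` jointly continuous on `S × E`,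
with `∂ₜu + (b·∇)u = νΔu − ∇p + f` and `div b = 0` on `S × E`. Then for every test field `ψ` on `Q`,
`∫∫_Q (⟪u, ∂ₜψ⟫ + ⟪u, (b·∇)ψ⟫ + ν ⟪u, Δψ⟫ + p div ψ + ⟪f, ψ⟫) = 0` (Leray 1934, (5.15) for the
regularised system; the proof of `isDistributionalNSSolutionOn_of_contDiffOn` with the drift).
[cite: Leray1934, Ch. V §26 (5.1)] [cite: OzanskiPooley2018, (6.89)] -/
theorem setIntegral_drift_weak_identity_of_contDiffOn (hS : IsOpen S)
    (hQ : (Q : Set (ℝ × E)) ⊆ S ×ˢ univ) (hu : ContDiffOn ℝ 2 (uncurry u) (S ×ˢ univ))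
    (hb : ContDiffOn ℝ 1 (uncurry b) (S ×ˢ univ))
    (hp : ContDiffOn ℝ 1 (uncurry p) (S ×ˢ univ)) (hf : ContinuousOn (uncurry f) (S ×ˢ univ))
    (hmom : ∀ t ∈ S, ∀ x, timeDeriv u t x + convect (b t) (u t) x =
      ν • (Δ (u t)) x - gradient (p t) x + f t x)
    (hdiva : ∀ t ∈ S, VectorCalculus.IsDivFree (b t))
    {ψ : ℝ → E → E} (hψ : IsSpaceTimeTestOn Q ψ) :
    ∫ z in (Q : Set (ℝ × E)), (⟪u z.1 z.2, timeDeriv ψ z.1 z.2⟫ +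
        ⟪u z.1 z.2, convect (b z.1) (ψ z.1) z.2⟫ + ν * ⟪u z.1 z.2, (Δ (ψ z.1)) z.2⟫ +
        p z.1 z.2 * VectorCalculus.divergence (ψ z.1) z.2 + ⟪f z.1 z.2, ψ z.1 z.2⟫) = 0 := by
  have hu1 : ContDiffOn ℝ 1 (uncurry u) (S ×ˢ univ) := hu.of_le one_le_two
  have cu : ContinuousOn (uncurry u) (S ×ˢ univ) := hu.continuousOn
  have cu' : ContinuousOn (fun z : ℝ × E => u z.1 z.2) (S ×ˢ univ) := cu
  have cdrift : ContinuousOn (fun z : ℝ × E => b z.1 z.2) (S ×ˢ univ) := hb.continuousOn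
  have cp : ContinuousOn (fun z : ℝ × E => p z.1 z.2) (S ×ˢ univ) := hp.continuousOn
  have cf : ContinuousOn (fun z : ℝ × E => f z.1 z.2) (S ×ˢ univ) := hf
  have cdt : ContinuousOn (fun z : ℝ × E => timeDeriv u z.1 z.2) (S ×ˢ univ) :=
    continuousOn_timeDeriv_of_contDiffOn hS hu1
  have hincl : ∀ {t : ℝ}, t ∈ S → ∀ x : E, (fun y : E => (t, y)) x ∈ S ×ˢ (univ : Set E) :=
    fun ht x => ⟨ht, mem_univ x⟩
  · -- the momentum equation
    set K : Set (ℝ × E) := tsupport (uncurry ψ) with hK_def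
    have hK : IsCompact K := hψ.hasCompactSupport
    have hKQ : K ⊆ (Q : Set (ℝ × E)) := hψ.tsupport_subset
    have hKS : K ⊆ S ×ˢ univ := hKQ.trans hQ
    -- vanishing off `K`
    have hψ0 : ∀ z ∉ K, ψ z.1 z.2 = 0 := fun z hz =>
      (image_eq_zero_of_notMem_tsupport hz : uncurry ψ z = 0)
    have hDψ0 : ∀ z ∉ K, fderiv ℝ (ψ z.1) z.2 = 0 := fun z hz =>
      fderiv_of_notMem_tsupport ℝ (notMem_tsupport_slice_of_notMem hz)
    have hΔψ0 : ∀ z ∉ K, (Δ (ψ z.1)) z.2 = 0 := fun z hz =>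
      laplacian_eq_zero_of_notMem_tsupport (notMem_tsupport_slice_of_notMem hz)
    have hdivψ0 : ∀ z ∉ K, VectorCalculus.divergence (ψ z.1) z.2 = 0 := fun z hz =>
      divergence_eq_zero_of_notMem_tsupport (notMem_tsupport_slice_of_notMem hz)
    have hTψ0 : ∀ z ∉ K, timeDeriv ψ z.1 z.2 = 0 := fun z hz =>
      timeDeriv_eq_zero_off_tsupport hz
    -- the integrand and its continuity on `S × E`
    set G : ℝ × E → ℝ := fun z => ⟪u z.1 z.2, timeDeriv ψ z.1 z.2⟫ +
      ⟪u z.1 z.2, convect (b z.1) (ψ z.1) z.2⟫ + ν * ⟪u z.1 z.2, (Δ (ψ z.1)) z.2⟫ +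
      p z.1 z.2 * VectorCalculus.divergence (ψ z.1) z.2 + ⟪f z.1 z.2, ψ z.1 z.2⟫ with hG_def
    have cψ : Continuous fun z : ℝ × E => ψ z.1 z.2 := hψ.contDiff.continuous
    have cTψ : Continuous fun z : ℝ × E => timeDeriv ψ z.1 z.2 := hψ.continuous_timeDeriv
    have hGc : ContinuousOn G (S ×ˢ univ) := by
      refine ((((cu'.inner cTψ.continuousOn).add (cu'.inner
        (hψ.continuous_fderiv_slice.continuousOn.clm_apply cdrift))).add
        (continuousOn_const.mul (cu'.inner hψ.continuous_laplacian_slice.continuousOn))).add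
        (cp.mul hψ.continuous_divergence_slice.continuousOn)).add (cf.inner cψ.continuousOn)
    have hG0 : ∀ z ∉ K, G z = 0 := fun z hz => by
      simp only [hG_def, convect, hψ0 z hz, hDψ0 z hz, hΔψ0 z hz, hdivψ0 z hz, hTψ0 z hz]
      simp
    change ∫ z in (Q : Set (ℝ × E)), G z = 0
    rw [setIntegral_eq_integral_integral_of_continuousOn hS hK hKQ hQ hGc hG0]
    -- the pairing `a = ⟪u, ψ⟫`, `a' = ⟪u, ∂ₜψ⟫ + ⟪∂ₜu, ψ⟫`
    set a : ℝ → E → ℝ := fun s x => ⟪u s x, ψ s x⟫ with ha_def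
    set a' : ℝ → E → ℝ := fun s x => ⟪u s x, timeDeriv ψ s x⟫ + ⟪timeDeriv u s x, ψ s x⟫
      with ha'_def
    have hderiv : ∀ s ∈ S, ∀ x, HasDerivAt (fun σ => a σ x) (a' s x) s := by
      intro s hs x
      have hd := hasDerivAt_timeLine_of_contDiffOn hu1 (hS.mem_nhds hs) x
      have h1 := hd.inner ℝ (hψ.hasDerivAt_time s x)
      refine h1.congr_deriv ?_
      simp only [ha'_def]
      rw [show timeDeriv u s x = fderiv ℝ (uncurry u) (s, x) (1, 0) from hd.deriv]
    have ha0 : ∀ z ∉ K, a z.1 z.2 = 0 := fun z hz => by simp [ha_def, hψ0 z hz]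
    have ha0' : ∀ z ∉ K, a' z.1 z.2 = 0 := fun z hz => by
      simp only [ha'_def, hψ0 z hz, hTψ0 z hz, inner_zero_right, add_zero]
    have hcont : ContinuousOn (uncurry a') (S ×ˢ univ) :=
      (cu'.inner cTψ.continuousOn).add (cdt.inner cψ.continuousOn)
    have key : ∀ t, ∫ x, G (t, x) = ∫ x, a' t x := by
      intro t
      by_cases ht : t ∈ S
      · -- slice regularity
        have hu2t : ContDiff ℝ 2 (u t) := contDiff_slice_of_contDiffOn hu ht
        have hp1t : ContDiff ℝ 1 (p t) := contDiff_slice_of_contDiffOn hp ht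
        have hbt : ContDiff ℝ 1 (b t) := contDiff_slice_of_contDiffOn hb ht
        have hdtt : Continuous (timeDeriv u t) := cdt.comp_continuous (Continuous.prodMk_right t)
          (hincl ht)
        have hft : Continuous (f t) := cf.comp_continuous (Continuous.prodMk_right t) (hincl ht)
        have hut : Continuous (u t) := hu2t.continuous
        have hbct : Continuous (b t) := hbt.continuous
        have hψ2 : ContDiff ℝ 2 (ψ t) := contDiff_infty.1 (hψ.contDiff_slice t) 2
        have hψct : HasCompactSupport (ψ t) := hψ.hasCompactSupport_slice t
        have hslice := integral_inner_dt_test_of_drift_momentum hu2t hbt hp1t hdtt hft (hmom t ht)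
          (hdiva t ht) hψ2 hψct
        -- compact `x`-support of the slice integrands
        have hKx : IsCompact (Prod.snd '' K) := hK.image continuous_snd
        have hx0 : ∀ x, x ∉ Prod.snd '' K → (t, x) ∉ K := fun x hx h => hx ⟨(t, x), h, rfl⟩
        have iT : Integrable (fun x => ⟪u t x, timeDeriv ψ t x⟫) (volume : Measure E) :=
          (hut.inner (cTψ.comp (Continuous.prodMk_right t))).integrable_of_hasCompactSupport
            (HasCompactSupport.intro hKx fun x hx => by
              rw [hTψ0 (t, x) (hx0 x hx), inner_zero_right])
        have iT' : Integrable (fun x => ⟪timeDeriv u t x, ψ t x⟫) (volume : Measure E) :=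
          integrable_inner_of_hasCompactSupport_right hdtt hψ2.continuous hψct
        have iR : Integrable (fun x => ⟪u t x, convect (b t) (ψ t) x⟫ +
            ν * ⟪u t x, (Δ (ψ t)) x⟫ + p t x * VectorCalculus.divergence (ψ t) x +
            ⟪f t x, ψ t x⟫) (volume : Measure E) := by
          refine Continuous.integrable_of_hasCompactSupport ?_
            (HasCompactSupport.intro hKx fun x hx => ?_)
          · exact (((hut.inner (((hψ2.continuous_fderiv two_ne_zero)).clm_apply hbct)).add
              (continuous_const.mul (hut.inner (continuous_laplacian hψ2)))).add
              (hp1t.continuous.mul (continuous_divergence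
                ((hψ2.of_le one_le_two).continuous_fderiv one_ne_zero)))).add
              (hft.inner hψ2.continuous)
          · have hz := hx0 x hx
            simp only [convect, hDψ0 (t, x) hz, hΔψ0 (t, x) hz, hdivψ0 (t, x) hz, hψ0 (t, x) hz]
            simp
        have e1 : ∫ x, G (t, x) = (∫ x, ⟪u t x, timeDeriv ψ t x⟫) +
            ∫ x, (⟪u t x, convect (b t) (ψ t) x⟫ + ν * ⟪u t x, (Δ (ψ t)) x⟫ +
              p t x * VectorCalculus.divergence (ψ t) x + ⟪f t x, ψ t x⟫) := by
          rw [← integral_add iT iR]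
          refine integral_congr_ae (Eventually.of_forall fun x => ?_)
          simp only [hG_def]
          ring
        have e2 : ∫ x, a' t x = (∫ x, ⟪u t x, timeDeriv ψ t x⟫) + ∫ x, ⟪timeDeriv u t x, ψ t x⟫ := by
          rw [← integral_add iT iT']
        rw [e1, e2, hslice]
      · refine integral_congr_ae (Eventually.of_forall fun x => ?_)
        have hz : (t, x) ∉ K := fun h => ht (hKS h).1
        simp only
        rw [hG0 (t, x) hz, ha0' (t, x) hz]
    rw [integral_congr_ae (Eventually.of_forall key)]
    exact integral_integral_eq_zero_of_hasDerivAt_time hS hK hKS hderiv ha0 ha0' hcont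

/-- **Leray's local energy equality for classical drift solutions, space–time form.** In the
setting of `setIntegral_drift_weak_identity_of_contDiffOn` with moreover `div u = 0`, for every
scalar test function `φ` on `Q`,
`2ν ∫∫ |∇u|² φ = ∫∫ (|u|² (∂ₜφ + νΔφ) + |u|² ⟪b, ∇φ⟫ + 2 p ⟪u, ∇φ⟫ + 2 ⟪f, u⟫ φ)`
(Leray 1934, §27, (5.3); Caffarelli–Kohn–Nirenberg 1982, §2, (2.5) with equality; the proof of
`local_energy_eq_of_contDiffOn` with the transport velocity `b`). [cite: Leray1934, Ch. V §27 (5.3)] [cite: CaffarelliKohnNirenberg1982, §2 (2.5)] -/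
theorem drift_local_energy_eq_of_contDiffOn (hS : IsOpen S)
    (hQ : (Q : Set (ℝ × E)) ⊆ S ×ˢ univ) (hu : ContDiffOn ℝ 2 (uncurry u) (S ×ˢ univ))
    (hb : ContDiffOn ℝ 1 (uncurry b) (S ×ˢ univ))
    (hp : ContDiffOn ℝ 1 (uncurry p) (S ×ˢ univ)) (hf : ContinuousOn (uncurry f) (S ×ˢ univ))
    (hmom : ∀ t ∈ S, ∀ x, timeDeriv u t x + convect (b t) (u t) x =
      ν • (Δ (u t)) x - gradient (p t) x + f t x)
    (hdiva : ∀ t ∈ S, VectorCalculus.IsDivFree (b t))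
    (hdiv : ∀ t ∈ S, VectorCalculus.IsDivFree (u t)) {φ : ℝ → E → ℝ} (hφ : IsSpaceTimeTestOn Q φ) :
    2 * ν * ∫ t, ∫ x, frobeniusNormSq (fderiv ℝ (u t) x) * φ t x =
      ∫ t, ∫ x, (‖u t x‖ ^ 2 * (timeDeriv φ t x + ν * (Δ (φ t)) x) +
        ‖u t x‖ ^ 2 * ⟪b t x, gradient (φ t) x⟫ + 2 * p t x * ⟪u t x, gradient (φ t) x⟫ +
        2 * ⟪f t x, u t x⟫ * φ t x) := by
  have hu1 : ContDiffOn ℝ 1 (uncurry u) (S ×ˢ univ) := hu.of_le one_le_two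
  have cu' : ContinuousOn (fun z : ℝ × E => u z.1 z.2) (S ×ˢ univ) := hu.continuousOn
  have cdrift : ContinuousOn (fun z : ℝ × E => b z.1 z.2) (S ×ˢ univ) := hb.continuousOn
  have cp : ContinuousOn (fun z : ℝ × E => p z.1 z.2) (S ×ˢ univ) := hp.continuousOn
  have cf : ContinuousOn (fun z : ℝ × E => f z.1 z.2) (S ×ˢ univ) := hf
  have cdt : ContinuousOn (fun z : ℝ × E => timeDeriv u z.1 z.2) (S ×ˢ univ) :=
    continuousOn_timeDeriv_of_contDiffOn hS hu1
  have cDu : ContinuousOn (fun z : ℝ × E => fderiv ℝ (u z.1) z.2) (S ×ˢ univ) :=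
    continuousOn_fderiv_slice_of_contDiffOn hu1 hS.uniqueDiffOn
  have hincl : ∀ {t : ℝ}, t ∈ S → ∀ x : E, (fun y : E => (t, y)) x ∈ S ×ˢ (univ : Set E) :=
    fun ht x => ⟨ht, mem_univ x⟩
  set K : Set (ℝ × E) := tsupport (uncurry φ) with hK_def
  have hK : IsCompact K := hφ.hasCompactSupport
  have hKQ : K ⊆ (Q : Set (ℝ × E)) := hφ.tsupport_subset
  have hKS : K ⊆ S ×ˢ univ := hKQ.trans hQ
  -- vanishing off `K`
  have hφ0 : ∀ z ∉ K, φ z.1 z.2 = 0 := fun z hz =>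
    (image_eq_zero_of_notMem_tsupport hz : uncurry φ z = 0)
  have hDφ0 : ∀ z ∉ K, fderiv ℝ (φ z.1) z.2 = 0 := fun z hz =>
    fderiv_of_notMem_tsupport ℝ (notMem_tsupport_slice_of_notMem hz)
  have hgφ0 : ∀ z ∉ K, gradient (φ z.1) z.2 = 0 := fun z hz =>
    gradient_eq_zero_of_notMem_tsupport (notMem_tsupport_slice_of_notMem hz)
  have hΔφ0 : ∀ z ∉ K, (Δ (φ z.1)) z.2 = 0 := fun z hz =>
    laplacian_eq_zero_of_notMem_tsupport (notMem_tsupport_slice_of_notMem hz)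
  have hTφ0 : ∀ z ∉ K, timeDeriv φ z.1 z.2 = 0 := fun z hz =>
    timeDeriv_eq_zero_off_tsupport hz
  -- joint continuity of the test-function derivatives
  have cφ : Continuous fun z : ℝ × E => φ z.1 z.2 := hφ.contDiff.continuous
  have cTφ : Continuous fun z : ℝ × E => timeDeriv φ z.1 z.2 := hφ.continuous_timeDeriv
  have cgφ : Continuous fun z : ℝ × E => gradient (φ z.1) z.2 := hφ.continuous_slice_gradient
  have cΔφ : Continuous fun z : ℝ × E => (Δ (φ z.1)) z.2 := hφ.continuous_laplacian_slice
  -- the right-hand integrand `R` and the dissipation integrand `D`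
  set R : ℝ × E → ℝ := fun z => ‖u z.1 z.2‖ ^ 2 * (timeDeriv φ z.1 z.2 + ν * (Δ (φ z.1)) z.2) +
    ‖u z.1 z.2‖ ^ 2 * ⟪b z.1 z.2, gradient (φ z.1) z.2⟫ + 2 * p z.1 z.2 * ⟪u z.1 z.2, gradient (φ z.1) z.2⟫ +
    2 * ⟪f z.1 z.2, u z.1 z.2⟫ * φ z.1 z.2 with hR_def
  set D : ℝ × E → ℝ := fun z => frobeniusNormSq (fderiv ℝ (u z.1) z.2) * φ z.1 z.2 with hD_def
  have hR0 : ∀ z ∉ K, R z = 0 := fun z hz => by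
    simp only [hR_def, hφ0 z hz, hgφ0 z hz, hΔφ0 z hz, hTφ0 z hz]
    simp
  have hD0 : ∀ z ∉ K, D z = 0 := fun z hz => by simp only [hD_def, hφ0 z hz, mul_zero]
  have cD : ContinuousOn D (S ×ˢ univ) :=
    (LerayHopfProofs.continuous_frobeniusNormSq.comp_continuousOn cDu).mul cφ.continuousOn
  have cD' : Continuous D :=
    continuous_of_continuousOn_of_eq_zero (hS.prod isOpen_univ) hK.isClosed hKS cD hD0
  have iD : Integrable D ((volume : Measure ℝ).prod (volume : Measure E)) :=
    cD'.integrable_of_hasCompactSupport (HasCompactSupport.intro hK hD0)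
  -- the pairing `a = φ |u|²`, `a' = ∂ₜφ |u|² + φ ∂ₜ|u|²`
  set a : ℝ → E → ℝ := fun s x => φ s x * ‖u s x‖ ^ 2 with ha_def
  set a' : ℝ → E → ℝ := fun s x => timeDeriv φ s x * ‖u s x‖ ^ 2 +
    φ s x * (2 * ⟪u s x, timeDeriv u s x⟫) with ha'_def
  have hderiv : ∀ s ∈ S, ∀ x, HasDerivAt (fun σ => a σ x) (a' s x) s := by
    intro s hs x
    have hd := hasDerivAt_timeLine_of_contDiffOn hu1 (hS.mem_nhds hs) x
    have h1 := (hφ.hasDerivAt_time s x).mul hd.norm_sq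
    refine h1.congr_deriv ?_
    simp only [ha'_def]
    rw [show timeDeriv u s x = fderiv ℝ (uncurry u) (s, x) (1, 0) from hd.deriv]
  have ha0 : ∀ z ∉ K, a z.1 z.2 = 0 := fun z hz => by simp only [ha_def, hφ0 z hz, zero_mul]
  have ha0' : ∀ z ∉ K, a' z.1 z.2 = 0 := fun z hz => by
    simp only [ha'_def, hφ0 z hz, hTφ0 z hz, zero_mul, add_zero]
  have hcont : ContinuousOn (uncurry a') (S ×ˢ univ) :=
    (cTφ.continuousOn.mul (cu'.norm.pow 2)).add
      (cφ.continuousOn.mul (continuousOn_const.mul (cu'.inner cdt)))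
  have ca' : Continuous (uncurry a') :=
    continuous_of_continuousOn_of_eq_zero (hS.prod isOpen_univ) hK.isClosed hKS hcont
      fun z hz => ha0' z hz
  have ia' : Integrable (uncurry a') ((volume : Measure ℝ).prod (volume : Measure E)) :=
    ca'.integrable_of_hasCompactSupport (HasCompactSupport.intro hK fun z hz => ha0' z hz)
  have hpair : ∫ s, ∫ x, a' s x = 0 :=
    integral_integral_eq_zero_of_hasDerivAt_time hS hK hKS hderiv ha0 ha0' hcont
  -- the slice identity: `∫ R(t, ·) = ∫ a'(t, ·) + 2ν ∫ D(t, ·)`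
  have key : ∀ t, ∫ x, R (t, x) = (∫ x, a' t x) + 2 * ν * ∫ x, D (t, x) := by
    intro t
    by_cases ht : t ∈ S
    · have hu2t : ContDiff ℝ 2 (u t) := contDiff_slice_of_contDiffOn hu ht
      have hp1t : ContDiff ℝ 1 (p t) := contDiff_slice_of_contDiffOn hp ht
      have hbt : ContDiff ℝ 1 (b t) := contDiff_slice_of_contDiffOn hb ht
      have hdtt : Continuous (timeDeriv u t) := cdt.comp_continuous (Continuous.prodMk_right t)
        (hincl ht)
      have hft : Continuous (f t) := cf.comp_continuous (Continuous.prodMk_right t) (hincl ht)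
      have hut : Continuous (u t) := hu2t.continuous
      have hbct : Continuous (b t) := hbt.continuous
      have hφ2 : ContDiff ℝ 2 (φ t) := contDiff_infty.1 (hφ.contDiff_slice t) 2
      have hφct : HasCompactSupport (φ t) := hφ.hasCompactSupport_slice t
      have hslice := integral_energy_flux_eq_of_drift_momentum hu2t hbt hp1t hdtt hft (hmom t ht)
        (hdiva t ht) (hdiv t ht) hφ2 hφct
      have hKx : IsCompact (Prod.snd '' K) := hK.image continuous_snd
      have hx0 : ∀ x, x ∉ Prod.snd '' K → (t, x) ∉ K := fun x hx h => hx ⟨(t, x), h, rfl⟩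
      -- the two pieces `A = ∂ₜφ |u|²` and `C` (the flux terms) of `R(t, ·)`
      have iA : Integrable (fun x => timeDeriv φ t x * ‖u t x‖ ^ 2) (volume : Measure E) :=
        ((cTφ.comp (Continuous.prodMk_right t)).mul (hut.norm.pow 2)).integrable_of_hasCompactSupport
          (HasCompactSupport.intro hKx fun x hx => by
            show timeDeriv φ t x * ‖u t x‖ ^ 2 = 0
            rw [hTφ0 (t, x) (hx0 x hx), zero_mul])
      have iB : Integrable (fun x => φ t x * (2 * ⟪u t x, timeDeriv u t x⟫)) (volume : Measure E) :=
        (hφ2.continuous.mul (continuous_const.mul (hut.inner hdtt))).integrable_of_hasCompactSupport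
          hφct.mul_right
      have iC : Integrable (fun x => ν * ((Δ (φ t)) x * ‖u t x‖ ^ 2) +
          fderiv ℝ (φ t) x (b t x) * ‖u t x‖ ^ 2 + 2 * (p t x * fderiv ℝ (φ t) x (u t x)) +
          2 * (φ t x * ⟪f t x, u t x⟫)) (volume : Measure E) := by
        refine Continuous.integrable_of_hasCompactSupport ?_
          (HasCompactSupport.intro hKx fun x hx => ?_)
        · have hDφt : Continuous (fderiv ℝ (φ t)) :=
            (hφ2.of_le one_le_two).continuous_fderiv one_ne_zero
          exact (((continuous_const.mul ((continuous_laplacian hφ2).mul (hut.norm.pow 2))).add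
            ((hDφt.clm_apply hbct).mul (hut.norm.pow 2))).add
            (continuous_const.mul (hp1t.continuous.mul (hDφt.clm_apply hut)))).add
            (continuous_const.mul (hφ2.continuous.mul (hft.inner hut)))
        · have hz := hx0 x hx
          simp only [hDφ0 (t, x) hz, hΔφ0 (t, x) hz, hφ0 (t, x) hz]
          simp
      have e1 : ∫ x, R (t, x) = (∫ x, timeDeriv φ t x * ‖u t x‖ ^ 2) +
          ∫ x, (ν * ((Δ (φ t)) x * ‖u t x‖ ^ 2) + fderiv ℝ (φ t) x (b t x) * ‖u t x‖ ^ 2 +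
            2 * (p t x * fderiv ℝ (φ t) x (u t x)) + 2 * (φ t x * ⟪f t x, u t x⟫)) := by
        rw [← integral_add iA iC]
        refine integral_congr_ae (Eventually.of_forall fun x => ?_)
        simp only [hR_def]
        rw [show ⟪u t x, gradient (φ t) x⟫ = fderiv ℝ (φ t) x (u t x) by
          rw [gradient, real_inner_comm, InnerProductSpace.toDual_symm_apply],
          show ⟪b t x, gradient (φ t) x⟫ = fderiv ℝ (φ t) x (b t x) by
          rw [gradient, real_inner_comm, InnerProductSpace.toDual_symm_apply]]
        ring
      have e2 : ∫ x, a' t x = (∫ x, timeDeriv φ t x * ‖u t x‖ ^ 2) +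
          ∫ x, φ t x * (2 * ⟪u t x, timeDeriv u t x⟫) := by
        rw [← integral_add iA iB]
      rw [e1, e2, hslice]
      ring
    · have h1 : ∫ x, R (t, x) = 0 :=
        integral_eq_zero_of_ae (Eventually.of_forall fun x => hR0 (t, x) fun h => ht (hKS h).1)
      have h2 : ∫ x, a' t x = 0 :=
        integral_eq_zero_of_ae (Eventually.of_forall fun x => ha0' (t, x) fun h => ht (hKS h).1)
      have h3 : ∫ x, D (t, x) = 0 :=
        integral_eq_zero_of_ae (Eventually.of_forall fun x => hD0 (t, x) fun h => ht (hKS h).1)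
      rw [h1, h2, h3]
      ring
  -- integrate in time
  have jA : Integrable (fun t => ∫ x, a' t x) (volume : Measure ℝ) := ia'.integral_prod_left
  have jD : Integrable (fun t => 2 * ν * ∫ x, D (t, x)) (volume : Measure ℝ) :=
    iD.integral_prod_left.const_mul _
  change 2 * ν * ∫ t, ∫ x, D (t, x) = ∫ t, ∫ x, R (t, x)
  rw [integral_congr_ae (Eventually.of_forall key), integral_add jA jD, hpair, zero_add,
    integral_const_mul]

end SpaceTime

end Literature.Analysis.FluidPDE
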